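/-
HONEST FRAMING: certified error envelopes and provably optimal rounding/accumulation schemes for
low-precision formats under stated cost models; every table by two implementations; no hardware
or vendor claims.
-/
import Summits.Ventures.CertifiedArithmetic.LowPrec.OptDemotionRouting

/-!
# The demotion law (Theorem T8), part 8j: SCALE INVARIANCE of the routing value (homogeneity `BR_t(2c) = 2 BR_t(c)`)

For the weighted routing value of part 8a: shifting every exponent by `k` and reading the weight
`k` places higher changes nothing (`treeBRw_shift`), because routability, tops and injections are
translation invariant; at the actual weight `2^e` this is opt's homogeneity
`BR_t(2^k · c) = 2^k · BR_t(c)` (`treeBRw_zpow_shift`).  Needed to read a child's routing value at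
the parent's scale (the node step of the routing conjecture, opt R19/R20).
-/

namespace Summit.Ventures.CertifiedArithmetic.LowPrec.Opt

open Literature.ComputerArithmetic.JeannerodRump2018
open Literature.ComputerArithmetic.JeannerodRump2018.SumTree

section Shift

variable {q : ℕ} (k : ℤ)

/-- Translation preserves routability. -/
theorem routable_image_add_iff (S : Finset ℤ) : Routable q (S.image fun e => e + k) ↔ Routable q S := by
  constructor
  · intro h e he e' he'
    have := h (e + k) (Finset.mem_image_of_mem _ he) (e' + k) (Finset.mem_image_of_mem _ he')
    linarith
  · intro h x hx y hy
    obtain ⟨e, he, rfl⟩ := Finset.mem_image.1 hx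
    obtain ⟨e', he', rfl⟩ := Finset.mem_image.1 hy
    have := h e he e' he'
    linarith

/-- Translation is injective. -/
theorem add_injective : Function.Injective fun e : ℤ => e + k := fun a b h => by simpa using h

/-- The top of a translate. -/
theorem max'_image_add {S : Finset ℤ} (hne : S.Nonempty) (hne' : (S.image fun e => e + k).Nonempty) :
    (S.image fun e => e + k).max' hne' = S.max' hne + k := by
  refine le_antisymm (Finset.max'_le _ hne' _ fun y hy => ?_)
    (Finset.le_max' (S.image fun e => e + k) (S.max' hne + k)
      (Finset.mem_image.2 ⟨S.max' hne, Finset.max'_mem S hne, rfl⟩))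
  obtain ⟨x, hx, rfl⟩ := Finset.mem_image.1 hy
  linarith [Finset.le_max' S x hx]

/-- A valid split translates to a valid split. -/
theorem image_mem_splits {S : Finset ℤ} {e₀ : ℤ} {A B : Finset ℤ} (h : (A, B) ∈ splits q S e₀) :
    (A.image fun e => e + k, B.image fun e => e + k) ∈ splits q (S.image fun e => e + k) (e₀ + k) := by
  obtain ⟨h1, hA, hB⟩ := mem_splits.1 h
  refine mem_splits.2 ⟨?_, (routable_image_add_iff k A).2 hA, (routable_image_add_iff k B).2 hB⟩
  rcases h1 with ⟨hs, hB'⟩ | ⟨hs, hB'⟩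
  · left
    simp only at hs hB' ⊢
    exact ⟨Finset.image_subset_image hs, by rw [hB', Finset.image_sdiff _ _ (add_injective k)]⟩
  · right
    simp only at hs hB' ⊢
    have e1 : (insert (e₀ - (q : ℤ)) S).image (fun e => e + k) = insert (e₀ + k - (q : ℤ)) (S.image fun e => e + k) := by
      rw [Finset.image_insert]; congr 1; ring
    refine ⟨?_, ?_⟩
    · rw [← e1]; exact Finset.image_subset_image hs
    · rw [hB', Finset.image_sdiff _ _ (add_injective k), e1]

/-- One direction of translation invariance. -/
theorem treeBRw_shift_le (W : ℤ → ℚ) :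
    ∀ (t : SumTree) (S : Finset ℤ),
      treeBRw q (fun e => W (e + k)) t S ≤ treeBRw q W t (S.image fun e => e + k)
  | .leaf _, S => by simp
  | .node a b, S => by
      by_cases hne : S.Nonempty
      · have hne' : (S.image fun e => e + k).Nonempty := hne.image _
        have htop := max'_image_add k hne hne'
        have hfold := fold_max_nonneg (splits q (S.image fun e => e + k) ((S.image fun e => e + k).max' hne'))
          (fun AB => treeBRw q W a AB.1 + treeBRw q W b AB.2)
        rcases treeBRw_node_eq (q := q) (W := fun e => W (e + k)) (a := a) (b := b) hne with h0 | ⟨AB, hAB, hval⟩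
        · rw [h0, treeBRw_node q W a b hne', htop]
          rw [htop] at hfold
          linarith
        · rw [hval]
          have iha := treeBRw_shift_le W a AB.1
          have ihb := treeBRw_shift_le W b AB.2
          have hmem := image_mem_splits k (A := AB.1) (B := AB.2) hAB
          rw [← htop] at hmem
          have hs := split_le_treeBRw_node (q := q) (W := W) (a := a) (b := b) hne' hmem
          rw [htop] at hs
          linarith
      · rw [Finset.not_nonempty_iff_eq_empty.1 hne]; simp

end Shift

/-- TRANSLATION INVARIANCE: shifting every exponent by `k` and reading the weight `k` places higher
gives the same routing value. -/
theorem treeBRw_shift {q : ℕ} (k : ℤ) (W : ℤ → ℚ) (t : SumTree) (S : Finset ℤ) :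
    treeBRw q W t (S.image fun e => e + k) = treeBRw q (fun e => W (e + k)) t S := by
  refine le_antisymm ?_ (treeBRw_shift_le k W t S)
  have h := treeBRw_shift_le (q := q) (-k) (fun e => W (e + k)) t (S.image fun e => e + k)
  have e1 : ((S.image fun e => e + k).image fun e => e + -k) = S := by
    rw [Finset.image_image]
    convert Finset.image_id (s := S) using 2
    funext e; simp
  have e2 : (fun e => (fun e => W (e + k)) (e + -k)) = W := by funext e; simp
  rw [e1, e2] at h
  exact h

/-- HOMOGENEITY at the actual weight: `BR_t` of the configuration shifted up by `k` places is `2^k`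
times `BR_t` (opt: `BR_t(2c) = 2 BR_t(c)`). -/
theorem treeBRw_zpow_shift {q : ℕ} (k : ℤ) (t : SumTree) (S : Finset ℤ) :
    treeBRw q (fun e => (2 : ℚ) ^ e) t (S.image fun e => e + k) =
      (2 : ℚ) ^ k * treeBRw q (fun e => (2 : ℚ) ^ e) t S := by
  rw [treeBRw_shift, ← treeBRw_smul (zpow_pos (by norm_num : (0 : ℚ) < 2) k).le]
  congr 1
  funext e
  rw [zpow_add₀ (by norm_num)]; ring

end Summit.Ventures.CertifiedArithmetic.LowPrec.Opt
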